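import Mathlib
import HarnessLib
import Summits.RiemannHypothesis.RiemannHypothesis.Theorems.DbrWallAntipersistenceLogSeven
import Summits.RiemannHypothesis.RiemannHypothesis.Theorems.DbrWallAntipersistenceLadder

/-!
# DBR column, rung B-P(P1): anti-persistence of the zeta screw line — rung `(log 8)/2`
# (`Ψ(2s) < 2Ψ(s)` for every `0 < s ≤ (log 8)/2`)

RH-FREE calculus inequality (LINE 1 of the label discipline): a theorem about the closed form (1.1) of Suzuki's
screw function `Ψ = Literature.NumberTheory.LFunctions.zetaScrew` with its prime terms `Λ(n)n^{−1/2}(t − log n)₊`,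
`n ≤ 8`; NOT worded as, and not, progress toward RH («`Ψ(2s) < 2Ψ(s)` for all `s > 0`» stays a conjecture from data).

Sixth rung of the ladder, the first one run through the LADDER LEMMA (`zetaScrew_two_mul_lt_two_mul_of_piece`):
piece `[(log 7)/2, (log 8)/2]`, `φ(2s)` carries `2, 3, 4, 5, 7`, `φ(s)` carries `2`; shape
`2Ψ(t) − Ψ(2t) = D(t) + (log 2/√2)(2t − log 2) + (αt + β)` (`two_mul_zetaScrew_sub_shape_log_seven_eight`);
lower end = the previous rung's theorem at `(log 7)/2`; upper end = ONE certificate at `s₁ = (log 8)/2 = (3/2) log 2`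
(`ρ = 8^{1/4}`, `1.681792 < ρ < 1.681793`, `e^{−λ'_k s₁} = ρ⁻¹8^{−(k+1)}`; twenty terms `≥ 0.26341` + tail
`≥ (1−8^{−21})²/85`, `4(ρ−1)² < 1.859367`; prime terms `(log 2)²/√2 + (log 3/√3)·log(8/3) + (log 2)²/2 +
(log 5/√5)·log(8/5) + (log 7/√7)·log(8/7) > 1.6384`; numerically `F((log 8)/2) = 0.0547`, margin `0.054`).
Result: `zetaScrew_two_mul_lt_two_mul_of_le_half_log_eight`. Nothing here bears on the truth of RH.
References: M. Suzuki, J. Lond. Math. Soc. (2) 108 (2023) = arXiv:2206.03682, (1.1) [Suzuki2023]. -/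

set_option linter.dupNamespace false

noncomputable section

open scoped BigOperators
open Set
namespace Summit.RiemannHypothesis.RiemannHypothesis.Theorems.DbrWall

open Literature.NumberTheory.LFunctions

/-! ### The prime sum on `log 7 ≤ t ≤ log 8` and the shape of the gap on the piece -/

/-- For `log 7 ≤ t ≤ log 8`: `φ(t) = (log 2/√2)(t − log 2) + (log 3/√3)(t − log 3) + (log 2/2)(t − log 4)
+ (log 5/√5)(t − log 5) + (log 7/√7)(t − log 7)`. [cite: Suzuki2023, (1.1)] -/
theorem zetaScrewPrimeSum_eq_of_log_seven_le {t : ℝ} (h7 : Real.log 7 ≤ t) (h8 : t ≤ Real.log 8) :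
    zetaScrewPrimeSum t = Real.log 2 / Real.sqrt 2 * (t - Real.log 2)
      + Real.log 3 / Real.sqrt 3 * (t - Real.log 3) + Real.log 2 / 2 * (t - Real.log 4)
      + Real.log 5 / Real.sqrt 5 * (t - Real.log 5) + Real.log 7 / Real.sqrt 7 * (t - Real.log 7) := by
  have h23 : Real.log 2 < Real.log 3 := Real.log_lt_log (by norm_num) (by norm_num)
  have h34 : Real.log 3 < Real.log 4 := Real.log_lt_log (by norm_num) (by norm_num)
  have h45 : Real.log 4 < Real.log 5 := Real.log_lt_log (by norm_num) (by norm_num)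
  have h57 : Real.log 5 < Real.log 7 := Real.log_lt_log (by norm_num) (by norm_num)
  have ht0 : 0 < t := lt_of_lt_of_le (Real.log_pos (by norm_num : (1:ℝ) < 7)) h7
  have hM : Real.exp |t| ≤ ((8 : ℕ) : ℝ) := by
    rw [abs_of_pos ht0]
    calc Real.exp t ≤ Real.exp (Real.log 8) := Real.exp_le_exp.2 h8
      _ = 8 := Real.exp_log (by norm_num)
      _ = ((8 : ℕ) : ℝ) := by norm_num
  rw [zetaScrewPrimeSum_eq_sum_max hM, abs_of_pos ht0,
    show Finset.Icc (1 : ℕ) 8 = {1, 2, 3, 4, 5, 6, 7, 8} from by decide,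
    Finset.sum_insert (by decide), Finset.sum_insert (by decide), Finset.sum_insert (by decide),
    Finset.sum_insert (by decide), Finset.sum_insert (by decide), Finset.sum_insert (by decide),
    Finset.sum_insert (by decide), Finset.sum_singleton]
  have h1 : ArithmeticFunction.vonMangoldt 1 = 0 := ArithmeticFunction.vonMangoldt_apply_one
  have hΛ2 : ArithmeticFunction.vonMangoldt 2 = Real.log 2 := by
    rw [ArithmeticFunction.vonMangoldt_apply_prime Nat.prime_two]; norm_num
  have hΛ3 : ArithmeticFunction.vonMangoldt 3 = Real.log 3 := by
    rw [ArithmeticFunction.vonMangoldt_apply_prime Nat.prime_three]; norm_num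
  have hΛ4 : ArithmeticFunction.vonMangoldt 4 = Real.log 2 := by
    rw [show (4 : ℕ) = 2 ^ 2 by norm_num, ArithmeticFunction.vonMangoldt_apply_pow two_ne_zero,
      ArithmeticFunction.vonMangoldt_apply_prime Nat.prime_two]; norm_num
  have hΛ5 : ArithmeticFunction.vonMangoldt 5 = Real.log 5 := by
    rw [ArithmeticFunction.vonMangoldt_apply_prime Nat.prime_five]; norm_num
  have hΛ6 : ArithmeticFunction.vonMangoldt 6 = 0 :=
    ArithmeticFunction.vonMangoldt_eq_zero_iff.2 (by decide)
  have hΛ7 : ArithmeticFunction.vonMangoldt 7 = Real.log 7 := by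
    rw [ArithmeticFunction.vonMangoldt_apply_prime Nat.prime_seven]; norm_num
  have hs4 : Real.sqrt ((4 : ℕ) : ℝ) = 2 := by
    rw [show ((4 : ℕ) : ℝ) = 2 ^ 2 by norm_num, Real.sqrt_sq (by norm_num)]
  have hm2 : max (t - Real.log ((2 : ℕ) : ℝ)) 0 = t - Real.log 2 := by
    push_cast; exact max_eq_left (by linarith)
  have hm3 : max (t - Real.log ((3 : ℕ) : ℝ)) 0 = t - Real.log 3 := by
    push_cast; exact max_eq_left (by linarith)
  have hm4 : max (t - Real.log ((4 : ℕ) : ℝ)) 0 = t - Real.log 4 := by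
    push_cast; exact max_eq_left (by linarith)
  have hm5 : max (t - Real.log ((5 : ℕ) : ℝ)) 0 = t - Real.log 5 := by
    push_cast; exact max_eq_left (by linarith)
  have hm7 : max (t - Real.log ((7 : ℕ) : ℝ)) 0 = t - Real.log 7 := by
    push_cast; exact max_eq_left (by linarith)
  have hm8 : max (t - Real.log ((8 : ℕ) : ℝ)) 0 = 0 := by
    push_cast; exact max_eq_right (by linarith)
  rw [h1, hΛ2, hΛ3, hΛ4, hΛ5, hΛ6, hΛ7, hs4, hm2, hm3, hm4, hm5, hm7, hm8]
  push_cast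
  ring

/-- **Shape of the gap on `[(log 7)/2, (log 8)/2]`**: `2Ψ(t) − Ψ(2t) = D(t) + (log 2/√2)(2t − log 2) + (αt + β)` with the
affine remainder of the prime ramps of `3, 4, 5, 7` (in `φ(2t)`) and `2` (in `φ(t)`). [folklore] -/
theorem two_mul_zetaScrew_sub_shape_log_seven_eight (t : ℝ) (h7 : Real.log 7 / 2 ≤ t) (h8 : t ≤ Real.log 8 / 2) :
    2 * zetaScrew t - zetaScrew (2 * t) =
      (∑' k : ℕ, (1 - Real.exp (-((2 * (k : ℝ) + 5 / 2) * t))) ^ 2 / (2 * (k : ℝ) + 5 / 2) ^ 2)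
      - 4 * (Real.exp (t / 2) - 1) ^ 2 + Real.log 2 / Real.sqrt 2 * (2 * t - Real.log 2)
      + ((2 * (Real.log 3 / Real.sqrt 3) + Real.log 2 + 2 * (Real.log 5 / Real.sqrt 5)
          + 2 * (Real.log 7 / Real.sqrt 7) - 2 * (Real.log 2 / Real.sqrt 2)) * t
        + (-(Real.log 3 / Real.sqrt 3 * Real.log 3) - Real.log 2 / 2 * Real.log 4
          - Real.log 5 / Real.sqrt 5 * Real.log 5 - Real.log 7 / Real.sqrt 7 * Real.log 7
          + 2 * (Real.log 2 / Real.sqrt 2) * Real.log 2)) := by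
  have hl2 : 0 < Real.log 2 := Real.log_pos one_lt_two
  have h27 : 2 * Real.log 2 < Real.log 7 := by
    have h' : Real.log 4 < Real.log 7 := Real.log_lt_log (by norm_num) (by norm_num)
    have h4 : Real.log 4 = 2 * Real.log 2 := by
      rw [show (4 : ℝ) = 2 ^ 2 by norm_num, Real.log_pow]; norm_num
    linarith
  have h89 : Real.log 8 < 2 * Real.log 3 := by
    have h' : Real.log 8 < Real.log 9 := Real.log_lt_log (by norm_num) (by norm_num)
    have h9 : Real.log 9 = 2 * Real.log 3 := by
      rw [show (9 : ℝ) = 3 ^ 2 by norm_num, Real.log_pow]; norm_num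
    linarith
  have hs0 : 0 ≤ t := by linarith
  have hs2 : Real.log 2 ≤ t := by linarith
  have hs3 : t ≤ Real.log 3 := by linarith
  rw [two_mul_zetaScrew_sub_eq_gap_add_primeSums hs0,
    zetaScrewPrimeSum_eq_of_log_seven_le (by linarith) (by linarith),
    zetaScrewPrimeSum_eq_of_log_two_le hs2 hs3]
  ring

/-! ### Constants and the certificate at `s₁ = (log 8)/2` -/

/-- `ρ := e^{(log 8)/4} = 8^{1/4}`: `ρ⁴ = 8` and `1.681792 < ρ < 1.681793`. [folklore] -/
theorem exp_log_eight_div_four_bounds :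
    Real.exp (Real.log 8 / 4) ^ 4 = 8 ∧ (1.681792 : ℝ) < Real.exp (Real.log 8 / 4)
      ∧ Real.exp (Real.log 8 / 4) < 1.681793 := by
  set r := Real.exp (Real.log 8 / 4) with hr
  have hr0 : 0 < r := Real.exp_pos _
  have hr4 : r ^ 4 = 8 := by
    rw [← Real.exp_nat_mul, show ((4 : ℕ) : ℝ) * (Real.log 8 / 4) = Real.log 8 by push_cast; ring,
      Real.exp_log (by norm_num)]
  refine ⟨hr4, ?_, ?_⟩
  · by_contra h
    push Not at h
    have := pow_le_pow_left₀ hr0.le h 4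
    rw [hr4] at this
    norm_num at this
  · by_contra h
    push Not at h
    have := pow_le_pow_left₀ (by norm_num) h 4
    rw [hr4] at this
    norm_num at this

/-- The gap exponentials at `s₁ = (log 8)/2`: `e^{−λ'_k s₁} = 8^{−(k+1)}·ρ⁻¹`. [folklore] -/
theorem exp_neg_lam_mul_half_log_eight (k : ℕ) :
    Real.exp (-((2 * (k : ℝ) + 5 / 2) * (Real.log 8 / 2)))
      = (1 / 8 : ℝ) ^ (k + 1) * (Real.exp (Real.log 8 / 4))⁻¹ := by
  set r := Real.exp (Real.log 8 / 4) with hr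
  have hr4 := exp_log_eight_div_four_bounds.1
  have h1 : Real.exp (-((2 * (k : ℝ) + 5 / 2) * (Real.log 8 / 2))) = r⁻¹ ^ (4 * k + 5) := by
    rw [show (2 * (k : ℝ) + 5 / 2) * (Real.log 8 / 2) = ((4 * k + 5 : ℕ) : ℝ) * (Real.log 8 / 4) by
      push_cast; ring, Real.exp_neg, Real.exp_nat_mul, inv_pow]
  have h2 : r⁻¹ ^ (4 * k + 5) = (r⁻¹ ^ 4) ^ (k + 1) * r⁻¹ := by ring
  have h3 : r⁻¹ ^ 4 = 1 / 8 := by rw [inv_pow, hr4, one_div]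
  rw [h1, h2, h3]

/-- `log(8/3) > 0.980829` (forty terms of `−log(1 − 5/8)`). [folklore] -/
theorem log_eight_thirds_gt : (0.980829 : ℝ) < Real.log (8 / 3) := by
  have hx : |(5 / 8 : ℝ)| < 1 := by rw [abs_of_pos (by norm_num)]; norm_num
  have h := Real.abs_log_sub_add_sum_range_le hx 40
  have hlog : Real.log (1 - 5 / 8 : ℝ) = -Real.log (8 / 3) := by
    rw [show (1 - 5 / 8 : ℝ) = (8 / 3)⁻¹ by norm_num, Real.log_inv]
  rw [hlog, abs_of_pos (by norm_num : (0 : ℝ) < 5 / 8)] at h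
  have h' := (abs_le.1 h).2
  simp only [Finset.sum_range_succ, Finset.sum_range_zero] at h'
  norm_num at h'
  linarith

/-- `log(8/5) > 0.4700035` (sixteen terms of `−log(1 − 3/8)`). [folklore] -/
theorem log_eight_fifths_gt : (0.4700035 : ℝ) < Real.log (8 / 5) := by
  have hx : |(3 / 8 : ℝ)| < 1 := by rw [abs_of_pos (by norm_num)]; norm_num
  have h := Real.abs_log_sub_add_sum_range_le hx 16
  have hlog : Real.log (1 - 3 / 8 : ℝ) = -Real.log (8 / 5) := by
    rw [show (1 - 3 / 8 : ℝ) = (8 / 5)⁻¹ by norm_num, Real.log_inv]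
  rw [hlog, abs_of_pos (by norm_num : (0 : ℝ) < 3 / 8)] at h
  have h' := (abs_le.1 h).2
  simp only [Finset.sum_range_succ, Finset.sum_range_zero] at h'
  norm_num at h'
  linarith

/-- `log(8/7) > 0.1335313` (eight terms of `−log(1 − 1/8)`). [folklore] -/
theorem log_eight_sevenths_gt : (0.1335313 : ℝ) < Real.log (8 / 7) := by
  have hx : |(1 / 8 : ℝ)| < 1 := by rw [abs_of_pos (by norm_num)]; norm_num
  have h := Real.abs_log_sub_add_sum_range_le hx 8
  have hlog : Real.log (1 - 1 / 8 : ℝ) = -Real.log (8 / 7) := by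
    rw [show (1 - 1 / 8 : ℝ) = (8 / 7)⁻¹ by norm_num, Real.log_inv]
  rw [hlog, abs_of_pos (by norm_num : (0 : ℝ) < 1 / 8)] at h
  have h' := (abs_le.1 h).2
  simp only [Finset.sum_range_succ, Finset.sum_range_zero] at h'
  norm_num at h'
  linarith

set_option maxHeartbeats 400000 in
/-- The prime terms at `s₁ = (log 8)/2` in the affine form: `(log 2/√2)(2s₁ − log 2) + (αs₁ + β)
= (log 2)²/√2 + (log 3/√3)·log(8/3) + (log 2/2)·log 2 + (log 5/√5)·log(8/5) + (log 7/√7)·log(8/7) > 1.6384`.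
[folklore] -/
theorem prime_terms_half_log_eight_gt :
    (1.6384 : ℝ) < Real.log 2 / Real.sqrt 2 * (2 * (Real.log 8 / 2) - Real.log 2)
      + ((2 * (Real.log 3 / Real.sqrt 3) + Real.log 2 + 2 * (Real.log 5 / Real.sqrt 5)
          + 2 * (Real.log 7 / Real.sqrt 7) - 2 * (Real.log 2 / Real.sqrt 2)) * (Real.log 8 / 2)
        + (-(Real.log 3 / Real.sqrt 3 * Real.log 3) - Real.log 2 / 2 * Real.log 4
          - Real.log 5 / Real.sqrt 5 * Real.log 5 - Real.log 7 / Real.sqrt 7 * Real.log 7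
          + 2 * (Real.log 2 / Real.sqrt 2) * Real.log 2)) := by
  have h8 : Real.log 8 = 3 * Real.log 2 := by
    rw [show (8 : ℝ) = 2 ^ 3 by norm_num, Real.log_pow]; norm_num
  have h4 : Real.log 4 = 2 * Real.log 2 := by
    rw [show (4 : ℝ) = 2 ^ 2 by norm_num, Real.log_pow]; norm_num
  have h83 : Real.log (8 / 3) = Real.log 8 - Real.log 3 := Real.log_div (by norm_num) (by norm_num)
  have h85 : Real.log (8 / 5) = Real.log 8 - Real.log 5 := Real.log_div (by norm_num) (by norm_num)
  have h87 : Real.log (8 / 7) = Real.log 8 - Real.log 7 := Real.log_div (by norm_num) (by norm_num)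
  have hgoal : Real.log 2 / Real.sqrt 2 * (2 * (Real.log 8 / 2) - Real.log 2)
      + ((2 * (Real.log 3 / Real.sqrt 3) + Real.log 2 + 2 * (Real.log 5 / Real.sqrt 5)
          + 2 * (Real.log 7 / Real.sqrt 7) - 2 * (Real.log 2 / Real.sqrt 2)) * (Real.log 8 / 2)
        + (-(Real.log 3 / Real.sqrt 3 * Real.log 3) - Real.log 2 / 2 * Real.log 4
          - Real.log 5 / Real.sqrt 5 * Real.log 5 - Real.log 7 / Real.sqrt 7 * Real.log 7
          + 2 * (Real.log 2 / Real.sqrt 2) * Real.log 2))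
      = Real.log 2 / Real.sqrt 2 * Real.log 2 + Real.log 3 / Real.sqrt 3 * Real.log (8 / 3)
        + Real.log 2 / 2 * Real.log 2 + Real.log 5 / Real.sqrt 5 * Real.log (8 / 5)
        + Real.log 7 / Real.sqrt 7 * Real.log (8 / 7) := by
    rw [h83, h85, h87, h8, h4]; ring
  rw [hgoal]
  have hl2 := Real.log_two_gt_d9
  have hl83 := log_eight_thirds_gt
  have hl85 := log_eight_fifths_gt
  have hl87 := log_eight_sevenths_gt
  have hl3 : (1.09852 : ℝ) < Real.log 3 := by
    have h := log_three_halves_gt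
    have : Real.log 3 = Real.log 2 + Real.log (3 / 2) := by
      rw [Real.log_div (by norm_num) (by norm_num)]; ring
    linarith
  have hl5 : (1.609436 : ℝ) < Real.log 5 := by
    have h := log_five_fourths_gt
    have : Real.log 5 = 2 * Real.log 2 + Real.log (5 / 4) := by
      rw [Real.log_div (by norm_num) (by norm_num), show (4 : ℝ) = 2 ^ 2 by norm_num, Real.log_pow]
      push_cast; ring
    linarith
  have hl7 : (1.945908 : ℝ) < Real.log 7 := by
    have h := log_seven_fifths_gt
    have : Real.log 7 = Real.log 5 + Real.log (7 / 5) := by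
      rw [Real.log_div (by norm_num) (by norm_num)]; ring
    linarith
  have hs2 : 0 < Real.sqrt 2 := Real.sqrt_pos.2 (by norm_num)
  have hs3 : 0 < Real.sqrt 3 := Real.sqrt_pos.2 (by norm_num)
  have hs5 : 0 < Real.sqrt 5 := Real.sqrt_pos.2 (by norm_num)
  have hs7 : 0 < Real.sqrt 7 := Real.sqrt_pos.2 (by norm_num)
  have hs2u : Real.sqrt 2 < 1.41422 := by
    have h := Real.sq_sqrt (show (0 : ℝ) ≤ 2 by norm_num)
    nlinarith [Real.sqrt_nonneg 2]
  have hs3u : Real.sqrt 3 < 1.73206 := by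
    have h := Real.sq_sqrt (show (0 : ℝ) ≤ 3 by norm_num)
    nlinarith [Real.sqrt_nonneg 3]
  have hs5u : Real.sqrt 5 < 2.23607 := by
    have h := Real.sq_sqrt (show (0 : ℝ) ≤ 5 by norm_num)
    nlinarith [Real.sqrt_nonneg 5]
  have hs7u : Real.sqrt 7 < 2.64576 := by
    have h := Real.sq_sqrt (show (0 : ℝ) ≤ 7 by norm_num)
    nlinarith [Real.sqrt_nonneg 7]
  have hp2 : (0.6931471803 : ℝ) * 0.6931471803 ≤ Real.log 2 * Real.log 2 :=
    mul_le_mul hl2.le hl2.le (by norm_num) (by linarith)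
  have hA : (0.33972 : ℝ) < Real.log 2 / Real.sqrt 2 * Real.log 2 := by
    rw [div_mul_eq_mul_div, lt_div_iff₀ hs2]
    have hq := mul_lt_mul_of_pos_left hs2u (show (0 : ℝ) < 0.33972 by norm_num)
    linarith
  have hB : (0.62205 : ℝ) < Real.log 3 / Real.sqrt 3 * Real.log (8 / 3) := by
    rw [div_mul_eq_mul_div, lt_div_iff₀ hs3]
    have hp : (1.09852 : ℝ) * 0.980829 ≤ Real.log 3 * Real.log (8 / 3) :=
      mul_le_mul hl3.le hl83.le (by norm_num) (by linarith)
    have hq := mul_lt_mul_of_pos_left hs3u (show (0 : ℝ) < 0.62205 by norm_num)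
    linarith
  have hC : (0.24021 : ℝ) < Real.log 2 / 2 * Real.log 2 := by linarith
  have hD : (0.33828 : ℝ) < Real.log 5 / Real.sqrt 5 * Real.log (8 / 5) := by
    rw [div_mul_eq_mul_div, lt_div_iff₀ hs5]
    have hp : (1.609436 : ℝ) * 0.4700035 ≤ Real.log 5 * Real.log (8 / 5) :=
      mul_le_mul hl5.le hl85.le (by norm_num) (by linarith)
    have hq := mul_lt_mul_of_pos_left hs5u (show (0 : ℝ) < 0.33828 by norm_num)
    linarith
  have hE : (0.0982 : ℝ) < Real.log 7 / Real.sqrt 7 * Real.log (8 / 7) := by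
    rw [div_mul_eq_mul_div, lt_div_iff₀ hs7]
    have hp : (1.945908 : ℝ) * 0.1335313 ≤ Real.log 7 * Real.log (8 / 7) :=
      mul_le_mul hl7.le hl87.le (by norm_num) (by linarith)
    have hq := mul_lt_mul_of_pos_left hs7u (show (0 : ℝ) < 0.0982 by norm_num)
    linarith
  linarith

/-- **`F((log 8)/2) > 0`** in the affine form of the ladder lemma (numerically `F = −1.5839 + 1.6386 = 0.0547`).
[folklore] -/
theorem gap_affine_half_log_eight_pos :
    0 < (∑' k : ℕ, (1 - Real.exp (-((2 * (k : ℝ) + 5 / 2) * (Real.log 8 / 2)))) ^ 2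
            / (2 * (k : ℝ) + 5 / 2) ^ 2)
        - 4 * (Real.exp (Real.log 8 / 2 / 2) - 1) ^ 2
        + Real.log 2 / Real.sqrt 2 * (2 * (Real.log 8 / 2) - Real.log 2)
        + ((2 * (Real.log 3 / Real.sqrt 3) + Real.log 2 + 2 * (Real.log 5 / Real.sqrt 5)
            + 2 * (Real.log 7 / Real.sqrt 7) - 2 * (Real.log 2 / Real.sqrt 2)) * (Real.log 8 / 2)
          + (-(Real.log 3 / Real.sqrt 3 * Real.log 3) - Real.log 2 / 2 * Real.log 4
            - Real.log 5 / Real.sqrt 5 * Real.log 5 - Real.log 7 / Real.sqrt 7 * Real.log 7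
            + 2 * (Real.log 2 / Real.sqrt 2) * Real.log 2)) := by
  set r := Real.exp (Real.log 8 / 4) with hr
  have hr0 : 0 < r := Real.exp_pos _
  obtain ⟨hr4, hr_lo, hr_hi⟩ := exp_log_eight_div_four_bounds
  have hrinv : r⁻¹ ≤ 0.59461 := by
    rw [inv_eq_one_div, div_le_iff₀ hr0]; nlinarith
  have hrinv1 : r⁻¹ ≤ 1 := by
    rw [inv_eq_one_div, div_le_iff₀ hr0]; nlinarith
  have hrinv0 : 0 ≤ r⁻¹ := by positivity
  have hs0 : (0 : ℝ) ≤ Real.log 8 / 2 := by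
    have := Real.log_nonneg (show (1 : ℝ) ≤ 8 by norm_num); positivity
  rw [show Real.log 8 / 2 / 2 = Real.log 8 / 4 by ring]
  simp only [exp_neg_lam_mul_half_log_eight]
  have hS : Summable fun k : ℕ =>
      (1 - (1 / 8 : ℝ) ^ (k + 1) * r⁻¹) ^ 2 / (2 * (k : ℝ) + 5 / 2) ^ 2 := by
    have := summable_gap_terms hs0
    simp only [exp_neg_lam_mul_half_log_eight] at this
    exact this
  rw [← hS.sum_add_tsum_nat_add 20]
  have hterm : ∀ k : ℕ, (1 - (1 / 8 : ℝ) ^ (k + 1) * 0.59461) ^ 2 / (2 * (k : ℝ) + 5 / 2) ^ 2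
      ≤ (1 - (1 / 8 : ℝ) ^ (k + 1) * r⁻¹) ^ 2 / (2 * (k : ℝ) + 5 / 2) ^ 2 := by
    intro k
    apply div_le_div_of_nonneg_right _ (by positivity)
    have hq0 : 0 ≤ (1 / 8 : ℝ) ^ (k + 1) := by positivity
    have hq1 : (1 / 8 : ℝ) ^ (k + 1) ≤ 1 := pow_le_one₀ (by norm_num) (by norm_num)
    have hlo : 0 ≤ 1 - (1 / 8 : ℝ) ^ (k + 1) * 0.59461 := by nlinarith
    have hle : 1 - (1 / 8 : ℝ) ^ (k + 1) * 0.59461 ≤ 1 - (1 / 8 : ℝ) ^ (k + 1) * r⁻¹ := by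
      nlinarith [mul_le_mul_of_nonneg_left hrinv hq0]
    exact pow_le_pow_left₀ hlo hle 2
  have hnum : (0.26341 : ℝ) ≤
      ∑ k ∈ Finset.range 20, (1 - (1 / 8 : ℝ) ^ (k + 1) * 0.59461) ^ 2 / (2 * (k : ℝ) + 5 / 2) ^ 2 := by
    simp only [Finset.sum_range_succ, Finset.sum_range_zero]
    norm_num
  have hhead : (0.26341 : ℝ) ≤
      ∑ k ∈ Finset.range 20, (1 - (1 / 8 : ℝ) ^ (k + 1) * r⁻¹) ^ 2 / (2 * (k : ℝ) + 5 / 2) ^ 2 :=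
    hnum.trans (Finset.sum_le_sum fun k _ => hterm k)
  have hT := Literature.Probability.LatticeModels.hasSum_telescope (show (0 : ℝ) < 85 / 4 by norm_num)
  have hTs : Summable fun k : ℕ =>
      (1 - (1 / 8 : ℝ) ^ 21) ^ 2 / 4 * (1 / (((k : ℝ) + 85 / 4) * ((k : ℝ) + 85 / 4 + 1))) :=
    (hT.mul_left _).summable
  have hTval : ∑' k : ℕ, (1 - (1 / 8 : ℝ) ^ 21) ^ 2 / 4 * (1 / (((k : ℝ) + 85 / 4) * ((k : ℝ) + 85 / 4 + 1)))
      = (1 - (1 / 8 : ℝ) ^ 21) ^ 2 / 4 * (1 / (85 / 4)) := (hT.mul_left _).tsum_eq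
  have htail : ∑' k : ℕ, (1 - (1 / 8 : ℝ) ^ 21) ^ 2 / 4 * (1 / (((k : ℝ) + 85 / 4) * ((k : ℝ) + 85 / 4 + 1)))
      ≤ ∑' k : ℕ, (1 - (1 / 8 : ℝ) ^ (k + 20 + 1) * r⁻¹) ^ 2 / (2 * ((k + 20 : ℕ) : ℝ) + 5 / 2) ^ 2 := by
    refine hTs.tsum_le_tsum (fun k => ?_) ((summable_nat_add_iff 20).2 hS)
    have hq0 : 0 ≤ (1 / 8 : ℝ) ^ (k + 20 + 1) * r⁻¹ := by positivity
    have hq1 : (1 / 8 : ℝ) ^ (k + 20 + 1) * r⁻¹ ≤ (1 / 8 : ℝ) ^ 21 := by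
      have h1 : (1 / 8 : ℝ) ^ (k + 20 + 1) ≤ (1 / 8 : ℝ) ^ 21 :=
        pow_le_pow_of_le_one (by norm_num) (by norm_num) (by omega)
      have h2 : (1 / 8 : ℝ) ^ (k + 20 + 1) * r⁻¹ ≤ (1 / 8 : ℝ) ^ (k + 20 + 1) * 1 :=
        mul_le_mul_of_nonneg_left hrinv1 (by positivity)
      linarith
    have hnum0 : 0 ≤ 1 - (1 / 8 : ℝ) ^ 21 := by norm_num
    have hnum1 : (1 - (1 / 8 : ℝ) ^ 21) ^ 2 ≤ (1 - (1 / 8 : ℝ) ^ (k + 20 + 1) * r⁻¹) ^ 2 :=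
      pow_le_pow_left₀ hnum0 (by linarith) 2
    have hk : (0 : ℝ) ≤ k := Nat.cast_nonneg k
    have hden : (2 * ((k + 20 : ℕ) : ℝ) + 5 / 2) ^ 2 ≤ 4 * (((k : ℝ) + 85 / 4) * ((k : ℝ) + 85 / 4 + 1)) := by
      push_cast; nlinarith
    have hden0 : 0 < (2 * ((k + 20 : ℕ) : ℝ) + 5 / 2) ^ 2 := by positivity
    rw [show (1 - (1 / 8 : ℝ) ^ 21) ^ 2 / 4 * (1 / (((k : ℝ) + 85 / 4) * ((k : ℝ) + 85 / 4 + 1)))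
        = (1 - (1 / 8 : ℝ) ^ 21) ^ 2 / (4 * (((k : ℝ) + 85 / 4) * ((k : ℝ) + 85 / 4 + 1))) by
      field_simp]
    exact div_le_div₀ (by positivity) hnum1 hden0 hden
  rw [hTval] at htail
  have htailnum : (0.01176 : ℝ) ≤ (1 - (1 / 8 : ℝ) ^ 21) ^ 2 / 4 * (1 / (85 / 4)) := by norm_num
  have hsub : 4 * (r - 1) ^ 2 < 1.859367 := by nlinarith
  have hprime := prime_terms_half_log_eight_gt
  linarith

/-! ### Assembly (ladder lemma) -/

/-- **Anti-persistence of the zeta screw line for every mesh up to `(log 8)/2`** (RH-FREE calculus inequality):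
`Ψ(2s) < 2Ψ(s)` for every `0 < s ≤ (log 8)/2`. [folklore] -/
theorem zetaScrew_two_mul_lt_two_mul_of_le_half_log_eight {s : ℝ} (hs0 : 0 < s)
    (hs : s ≤ Real.log 8 / 2) : zetaScrew (2 * s) < 2 * zetaScrew s := by
  rcases le_total s (Real.log 7 / 2) with h | h
  · exact zetaScrew_two_mul_lt_two_mul_of_le_half_log_seven hs0 h
  · have h7 : 0 < Real.log 7 / 2 := by
      have := Real.log_pos (show (1 : ℝ) < 7 by norm_num); positivity
    have h27 : Real.log 2 / 2 ≤ Real.log 7 / 2 := by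
      have := Real.log_lt_log (by norm_num) (show (2 : ℝ) < 7 by norm_num); linarith
    have h78 : Real.log 7 / 2 ≤ Real.log 8 / 2 := by
      have := Real.log_lt_log (by norm_num) (show (7 : ℝ) < 8 by norm_num); linarith
    -- lower end: the previous rung; upper end: the certificate through the shape
    have h0 : 0 < 2 * zetaScrew (Real.log 7 / 2) - zetaScrew (2 * (Real.log 7 / 2)) := by
      have := zetaScrew_two_mul_lt_two_mul_of_le_half_log_seven h7 le_rfl
      linarith
    have h1 : 0 < 2 * zetaScrew (Real.log 8 / 2) - zetaScrew (2 * (Real.log 8 / 2)) := by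
      rw [two_mul_zetaScrew_sub_shape_log_seven_eight (Real.log 8 / 2) h78 le_rfl]
      exact gap_affine_half_log_eight_pos
    exact zetaScrew_two_mul_lt_two_mul_of_piece h27 two_mul_zetaScrew_sub_shape_log_seven_eight h0 h1 h hs

/-- **Negative lag-one increment covariance for every mesh up to `(log 8)/2`**: `c₁(s) = Ψ(2s) − 2Ψ(s) + Ψ(0) < 0`.
[folklore] -/
theorem lagOne_increment_cov_neg_of_le_half_log_eight {s : ℝ} (hs0 : 0 < s) (hs : s ≤ Real.log 8 / 2) :
    zetaScrew (2 * s) - 2 * zetaScrew s + zetaScrew 0 < 0 := by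
  have h := zetaScrew_two_mul_lt_two_mul_of_le_half_log_eight hs0 hs
  rw [zetaScrew_zero]
  linarith

end Summit.RiemannHypothesis.RiemannHypothesis.Theorems.DbrWall
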